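import Literature.Probability.RandomPlanarGeometry.LoewnerAdapted
import Literature.Probability.RandomPlanarGeometry.SLEMartingale
import HarnessLib

/-!
# Swallowing times of SLE_κ are stopping times; the real SLE flow is adapted

Topic `Probability/RandomPlanarGeometry`; theorems only. Application of `LoewnerAdapted` (the real
Loewner flow and the events `{t < T_x}` are measurable functionals of the driving path up to time
`t`) to the SLE_κ driving function `W(ω) = √κ B(ω)` (`sleDriving`) and the raw Brownian filtration
`𝓕ᵂ` (`brownianFiltration`, `LocalMartingale`):

* `Literature.Probability.RandomPlanarGeometry.measurableSet_lt_swallowingTime_sle`: `{ω | t < T_x(ω)} ∈ 𝓕ᵂ_t` for every real `x ≠ 0`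
  (`x > 0` directly; `x < 0` by the reflection `W ↦ -W`, `x ↦ -x`, `swallowingTime_neg_ofReal`);
* `Literature.Probability.RandomPlanarGeometry.isStoppingTime_swallowingTime_sle`: the swallowing time `ω ↦ T_x(ω)` of a real point is an
  `𝓕ᵂ`-stopping time (for `x = 0` it is the constant `0`);
* **`Literature.Probability.RandomPlanarGeometry.isStoppingTime_swallowingStoppingTime_holds`**: discharge of the named fact
  `Literature.Probability.RandomPlanarGeometry.isStoppingTime_swallowingStoppingTime` of `SLEMartingale` (crit-perc.S22: the
  first swallowing time of the marks, `⨅ᵢ T_{xᵢ}`, is an `𝓕ᵂ`-stopping time), for *all* `κ` and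
  all mark vectors `x : Fin 3 → ℝ`;
* `Literature.Probability.RandomPlanarGeometry.measurable_realFlow_sle`: the real flow `ω ↦ re gₜ(x) - Wₜ` (on `{t < T_x}`, `0` elsewhere)
  is `𝓕ᵂ_t`-measurable for every real `x ≠ 0` — the adaptedness input for the Itô-step facts of
  the SLE martingales (`SLETwoPointMartingale`, crit-perc.S22).

Lawler (2005), §4.1 and Ch. 6 (`T_x`, `gₜ(x)` as functionals of the driving function);
Revuz–Yor (1999), Ch. I §4 (hitting times of adapted continuous processes are stopping times —
here for the raw filtration and the *open* condition `t < T_x`, via the measurable Picard scheme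
of `LoewnerAdapted` rather than path regularity of `T`).

## References

* G. F. Lawler, *Conformally Invariant Processes in the Plane* (2005), §4.1, §6.2.
* D. Revuz, M. Yor, *Continuous Martingales and Brownian Motion* (1999), Ch. I, §4.
-/

noncomputable section

open Set Filter MeasureTheory Complex
open scoped NNReal

namespace Literature.Probability.RandomPlanarGeometry

open Loewner

/-! ### Measurability of the driving function with respect to `𝓕ᵂ_t` -/

/-- `B_s` is `𝓕ᵂ_t`-measurable for `s ≤ t`. [folklore] -/
theorem measurable_brownian_of_le {s t : ℝ≥0} (hs : s ≤ t) :
    Measurable[brownianFiltration t] (Process.brownian s) :=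
  ((stronglyAdapted_brownian s).mono (brownianFiltration.mono hs)).measurable

/-- `W_s = √κ B_s` is `𝓕ᵂ_t`-measurable for `s ≤ t`. [folklore] -/
theorem measurable_sleDriving_of_le (κ : ℝ≥0) {s t : ℝ≥0} (hs : s ≤ t) :
    Measurable[brownianFiltration t] fun ω ↦ sleDriving κ ω s := by
  simp only [sleDriving_apply]
  exact (measurable_brownian_of_le hs).const_mul _

/-! ### `{t < T_x} ∈ 𝓕ᵂ_t` and stopping times -/

/-- For `x > 0`: `{ω | t < T_x(ω)} ∈ 𝓕ᵂ_t` (`LoewnerAdapted.measurableSet_lt_swallowingTime`).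
[cite: Lawler2005, Ch. 4 §4.1] -/
theorem measurableSet_lt_swallowingTime_sle_of_pos (κ : ℝ≥0) {x : ℝ} (hx : 0 < x) (t : ℝ≥0) :
    MeasurableSet[brownianFiltration t]
      {ω | (t : WithTop ℝ≥0) < swallowingTime (sleDriving κ ω) x} :=
  measurableSet_lt_swallowingTime (mΩ := brownianFiltration t) (W := fun ω ↦ sleDriving κ ω)
    (t := t) (fun ω ↦ continuous_sleDriving κ ω) (fun ω ↦ sleDriving_zero κ ω)
    (fun _ hs ↦ measurable_sleDriving_of_le κ hs) hx

/-- For `x < 0`: `{ω | t < T_x(ω)} ∈ 𝓕ᵂ_t`, by the reflection `W ↦ -W`, `x ↦ -x`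
(`swallowingTime_neg_ofReal`). [cite: Lawler2005, Ch. 4 §4.1] -/
theorem measurableSet_lt_swallowingTime_sle_of_neg (κ : ℝ≥0) {x : ℝ} (hx : x < 0) (t : ℝ≥0) :
    MeasurableSet[brownianFiltration t]
      {ω | (t : WithTop ℝ≥0) < swallowingTime (sleDriving κ ω) x} := by
  have h := measurableSet_lt_swallowingTime (mΩ := brownianFiltration t)
    (W := fun ω s ↦ -sleDriving κ ω s) (t := t) (fun ω ↦ (continuous_sleDriving κ ω).neg)
    (fun ω ↦ by simp [sleDriving_zero]) (fun _ hs ↦ (measurable_sleDriving_of_le κ hs).neg)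
    (neg_pos.2 hx)
  have hset : {ω : ℝ≥0 → ℝ | (t : WithTop ℝ≥0) <
      swallowingTime (fun s ↦ -sleDriving κ ω s) ((-x : ℝ) : ℂ)} =
      {ω | (t : WithTop ℝ≥0) < swallowingTime (sleDriving κ ω) x} := by
    ext ω
    simp only [mem_setOf_eq]
    rw [swallowingTime_neg_ofReal]
  rw [← hset]
  exact h

/-- **`{t < T_x} ∈ 𝓕ᵂ_t` for every real `x ≠ 0`.** [cite: Lawler2005, Ch. 4 §4.1] -/
theorem measurableSet_lt_swallowingTime_sle (κ : ℝ≥0) {x : ℝ} (hx : x ≠ 0) (t : ℝ≥0) :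
    MeasurableSet[brownianFiltration t]
      {ω | (t : WithTop ℝ≥0) < swallowingTime (sleDriving κ ω) x} := by
  rcases hx.lt_or_gt with h | h
  · exact measurableSet_lt_swallowingTime_sle_of_neg κ h t
  · exact measurableSet_lt_swallowingTime_sle_of_pos κ h t

/-- The swallowing time of the driving point itself is `0`, for every path. [folklore] -/
theorem swallowingTime_sleDriving_zero (κ : ℝ≥0) (ω : ℝ≥0 → ℝ) :
    swallowingTime (sleDriving κ ω) ((0 : ℝ) : ℂ) = 0 := by
  apply le_antisymm _ bot_le
  have := swallowingTime_driving_le (sleDriving κ ω)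
  rwa [sleDriving_zero] at this

/-- **The swallowing time of a real point is an `𝓕ᵂ`-stopping time** for SLE_κ (raw Brownian
filtration): `{T_x ≤ t} = {t < T_x}ᶜ ∈ 𝓕ᵂ_t` for `x ≠ 0`, and `T_0 ≡ 0`. Lawler (2005), §4.1;
Revuz–Yor (1999), Ch. I §4. [cite: Lawler2005, Ch. 4 §4.1] -/
theorem isStoppingTime_swallowingTime_sle (κ : ℝ≥0) (x : ℝ) :
    IsStoppingTime brownianFiltration fun ω ↦ swallowingTime (sleDriving κ ω) x := by
  intro t
  by_cases hx : x = 0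
  · subst hx
    have : {ω : ℝ≥0 → ℝ | swallowingTime (sleDriving κ ω) ((0 : ℝ) : ℂ) ≤ t} = univ :=
      eq_univ_of_forall fun ω ↦ by
        rw [mem_setOf_eq, swallowingTime_sleDriving_zero]
        exact bot_le
    rw [this]
    exact MeasurableSet.univ
  · have hset : {ω : ℝ≥0 → ℝ | swallowingTime (sleDriving κ ω) x ≤ t} =
        {ω | (t : WithTop ℝ≥0) < swallowingTime (sleDriving κ ω) x}ᶜ := by
      ext ω; simp only [mem_setOf_eq, mem_compl_iff, not_lt]
    rw [hset]
    exact (measurableSet_lt_swallowingTime_sle κ hx t).compl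

/-- **crit-perc.S22's stopping time** — discharge of the named fact
`Literature.Probability.RandomPlanarGeometry.isStoppingTime_swallowingStoppingTime` (`SLEMartingale`): the first swallowing time of
the marks `⨅ᵢ T_{xᵢ}` is an `𝓕ᵂ`-stopping time (a finite infimum of stopping times: it is attained,
so `{⨅ᵢ T_{xᵢ} ≤ t} = ⋃ᵢ {T_{xᵢ} ≤ t}`). Holds for every `κ` and every `x : Fin 3 → ℝ`.
Lawler (2005), Ch. 4 §4.1 and Ch. 6; Revuz–Yor (1999), Ch. I §4. [cite: Lawler2005, Ch. 4 §4.1] -/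
theorem isStoppingTime_swallowingStoppingTime_holds (κ : ℝ≥0) (x : Fin 3 → ℝ) :
    RandomPlanarGeometry.isStoppingTime_swallowingStoppingTime κ x := by
  intro t
  have hset : {ω : ℝ≥0 → ℝ | RandomPlanarGeometry.swallowingStoppingTime κ x ω ≤ t} =
      ⋃ i, {ω | swallowingTime (sleDriving κ ω) (x i) ≤ t} := by
    ext ω
    simp only [mem_setOf_eq, mem_iUnion, RandomPlanarGeometry.swallowingStoppingTime]
    constructor
    · intro h
      obtain ⟨i, hi⟩ := exists_eq_ciInf_of_finite
        (f := fun i ↦ swallowingTime (sleDriving κ ω) (x i))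
      exact ⟨i, by rw [hi]; exact h⟩
    · rintro ⟨i, hi⟩
      exact (iInf_le _ i).trans hi
  rw [hset]
  exact MeasurableSet.iUnion fun i ↦ isStoppingTime_swallowingTime_sle κ (x i) t

/-! ### The real SLE flow is adapted -/

/-- For `x > 0`: the real flow `ω ↦ re gₜ(x) - Wₜ` on `{t < T_x}` (`0` elsewhere) is
`𝓕ᵂ_t`-measurable (`LoewnerAdapted.measurable_realFlowTrunc`). [cite: Lawler2005, Ch. 4 §4.1] -/
theorem measurable_realFlow_sle_of_pos (κ : ℝ≥0) {x : ℝ} (hx : 0 < x) (t : ℝ≥0) :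
    Measurable[brownianFiltration t] fun ω ↦
      if (t : WithTop ℝ≥0) < swallowingTime (sleDriving κ ω) x then
        (map (sleDriving κ ω) t x).re - sleDriving κ ω t else 0 :=
  measurable_realFlowTrunc (mΩ := brownianFiltration t) (W := fun ω ↦ sleDriving κ ω) (t := t)
    (fun ω ↦ continuous_sleDriving κ ω) (fun ω ↦ sleDriving_zero κ ω)
    (fun _ hs ↦ measurable_sleDriving_of_le κ hs) hx

/-- Reflection of the real flow: for `t < T_x`,
`re (map (-W) t (-x)) - (-W t) = -(re (map W t x) - W t)`. [folklore] -/
theorem re_map_neg_sub (W : ℝ≥0 → ℝ) (hW : Continuous W) {x : ℝ} {t : ℝ≥0}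
    (ht : (t : WithTop ℝ≥0) < swallowingTime W x) :
    (map (fun s ↦ -W s) t ((-x : ℝ) : ℂ)).re - -W t = -((map W t x).re - W t) := by
  obtain ⟨g, hg⟩ := exists_isSolution_swallowingTime_holds hW (ne_driving_of_lt_swallowingTime ht)
  have h1 : ((-x : ℝ) : ℂ) = -(starRingEnd ℂ (x : ℂ)) := by simp
  rw [h1, map_eq_of_isSolution hW hg ht,
    map_eq_of_isSolution (W := fun s ↦ -W s) (hW.neg : Continuous fun s ↦ -W s) hg.neg_conj ht]
  simp only [neg_re, conj_re]
  ring

/-- For `x < 0`: the real flow on `{t < T_x}` is `𝓕ᵂ_t`-measurable (reflection of the positive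
case). [cite: Lawler2005, Ch. 4 §4.1] -/
theorem measurable_realFlow_sle_of_neg (κ : ℝ≥0) {x : ℝ} (hx : x < 0) (t : ℝ≥0) :
    Measurable[brownianFiltration t] fun ω ↦
      if (t : WithTop ℝ≥0) < swallowingTime (sleDriving κ ω) x then
        (map (sleDriving κ ω) t x).re - sleDriving κ ω t else 0 := by
  have h := measurable_realFlowTrunc (mΩ := brownianFiltration t)
    (W := fun ω s ↦ -sleDriving κ ω s) (t := t) (fun ω ↦ (continuous_sleDriving κ ω).neg)
    (fun ω ↦ by simp [sleDriving_zero]) (fun _ hs ↦ (measurable_sleDriving_of_le κ hs).neg)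
    (neg_pos.2 hx)
  have hfun : (fun ω : ℝ≥0 → ℝ ↦
      if (t : WithTop ℝ≥0) < swallowingTime (sleDriving κ ω) x then
        (map (sleDriving κ ω) t x).re - sleDriving κ ω t else 0) = fun ω ↦
      -(if (t : WithTop ℝ≥0) < swallowingTime (fun s ↦ -sleDriving κ ω s) ((-x : ℝ) : ℂ) then
        (map (fun s ↦ -sleDriving κ ω s) t ((-x : ℝ) : ℂ)).re - -sleDriving κ ω t else 0) := by
    ext ω
    rw [swallowingTime_neg_ofReal]
    split_ifs with hlt
    · rw [re_map_neg_sub (sleDriving κ ω) (continuous_sleDriving κ ω) hlt, neg_neg]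
    · simp
  rw [hfun]
  exact h.neg

/-- **The real SLE flow is adapted**: for every real `x ≠ 0` and time `t`, the real flow
`ω ↦ re gₜ(x) - Wₜ` on `{t < T_x}` (`0` elsewhere) is `𝓕ᵂ_t`-measurable. Lawler (2005), §4.1
(`gₜ(x)` is determined by the driving function up to time `t`). [cite: Lawler2005, Ch. 4 §4.1] -/
theorem measurable_realFlow_sle (κ : ℝ≥0) {x : ℝ} (hx : x ≠ 0) (t : ℝ≥0) :
    Measurable[brownianFiltration t] fun ω ↦
      if (t : WithTop ℝ≥0) < swallowingTime (sleDriving κ ω) x then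
        (map (sleDriving κ ω) t x).re - sleDriving κ ω t else 0 := by
  rcases hx.lt_or_gt with h | h
  · exact measurable_realFlow_sle_of_neg κ h t
  · exact measurable_realFlow_sle_of_pos κ h t

end Literature.Probability.RandomPlanarGeometry
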